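import Summits.BirchSwinnertonDyer.Rank2.Chi8FloorConductorLevel
import HarnessLib

/-!
# The χ₈-floor kernel, Part C of 8 — §TwistEngine, §TwistDoor

Planner p2 GEN 40–42 kernel `Chi8Floor` v10 (cell bsd-rank2, HOME/p2/g43/lean/Chi8Floor_v10.lean, sha bc257584; 60 theorems, `lean check` rc 0 / 0 sorry),
split into ≤400-line tree files `Rank2/Chi8Floor{Certificate,ConductorLevel,TwistDoor,LatticeEngine,TwistDoorProved,PeriodFree,TwistDoorFinal,KatoFree}`
(A–H, a linear import chain) by the lead star-p1 GEN 18 at the planner's LANDING ASK.  The mathematical overview, the honest framing (Barrier B1: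
`ord_{T=0} L₂` is the 2-adic analytic order, never `r_an`; BSD is not proved) and the references are in Part A's module docstring
(`Rank2/Chi8FloorCertificate.lean`); every theorem below carries its own `[cite: …]` tags.  Theorems only; no definition, no named fact, no instance.
[cite: MazurTateTeitelbaum1986Invent, §I.14 Proposition (p. 20)] [cite: Kato2004Asterisque, Thm. 18.4 (p. 281)] [cite: GreenbergLNM1716, §5 (p. 181)]
[cite: Stevens1989, Lemma (5.4)]
-/

noncomputable section

open PowerSeries WeierstrassCurve CongruenceSubgroup Filter
open Literature.NumberTheory.EllipticCurves Literature.NumberTheory.EllipticCurves.ModularForms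
open Literature.Barriers.BirchSwinnertonDyer

namespace Summit.BirchSwinnertonDyer.Rank2

section TwistEngine

/-! ### The twisted eighth symbol: `[1/8]⁺` of a quadratic twist and its parity

For a prime `q ∤ N` (odd), a rational newform `f` of level `N` and an integer-valued function `ε` on
`ℤ/q` (the Legendre symbol `(·/q)` in the application), the TWISTED EIGHTH SUM
`V_ε(f) := ∑_{u mod q} ε(u) [1/8 + u/q]⁺_f` is, by the tree's one-constant twisting formula
(`exists_rat_forall_ratPlusSymbol_charTwist_eq`, MTT §I.8), `c⁻¹ · [1/8]⁺_{f_χ}` for the twisted newform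
`f_χ`. The Hecke relation at the cusp `q/8` (`a_q [q/8]⁺ = ∑_u [1/8 + u/q]⁺ + [q²/8]⁺`, MTT §I.4 (4.2))
and `[q²/8]⁺ = [1/8]⁺` (periodicity, `8 ∣ q² − 1`) give the EXACT IDENTITY
`V_ε(f) = a_q [q/8]⁺ − 2[1/8]⁺ − (M_ε(f) − [1/8]⁺)`, `M_ε(f) := ∑_u (1 − ε(u)) [1/8 + u/q]⁺`
(`twistedEighthSum_eq`); for `ε = (·/q)`, `M_ε − [1/8]⁺ = 2 ∑_{(u/q) = −1} [1/8 + u/q]⁺`. Hence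
(`norm_twistedEighthSum_eq_one`): `a_q` odd, `[q/8]⁺` a `2`-adic unit, `[1/8]⁺ ∈ ℤ₍₂₎` and
`∑_{(u/q)=−1} [1/8 + u/q]⁺ ∈ ℤ₍₂₎` ("QNR half-sum 2-integral") ⇒ `V_ε(f)` is a `2`-adic UNIT. -/

variable {N : ℕ} [NeZero N] {f : CuspForm (Gamma0 N) 2}

/-- Reindexing `ℤ/q → Fin q` for sums of a function of the shift `u/q` (`twistShift u = u.val/q`). [folklore] -/
theorem sum_zmod_twistShift_eq_sum_fin {q : ℕ} [NeZero q] (g : ℚ → ℚ) :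
    ∑ u : ZMod q, g (twistShift u) = ∑ j : Fin q, g ((j : ℕ) / (q : ℚ)) := by
  obtain ⟨k, rfl⟩ := Nat.exists_eq_succ_of_ne_zero (NeZero.ne q)
  rfl

/-- **Hecke at the cusp `q/8`, rational form**: for an odd prime `q ∤ N` with `a_q(f) = a`,
`a [q/8]⁺_f = ∑_{u mod q} [1/8 + u/q]⁺_f + [1/8]⁺_f` (`intCast_mul_normalizedPlusSymbol` at `r = q/8`,
`(q/8 + j)/q = 1/8 + j/q`, `q·(q/8) = 1/8 + (q² − 1)/8`). [cite: MazurTateTeitelbaum1986Invent, §I.4 (4.2)] -/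
theorem intCast_mul_ratPlusSymbol_div_eight (hf : IsNewform0 f) (hQ : coeffField f = ⊥)
    {q : ℕ} [NeZero q] (hq : q.Prime) (hq2 : q ≠ 2) (hqN : ¬ q ∣ N) {a : ℤ} (ha : cuspCoeff f q = a) :
    (a : ℚ) * ratPlusSymbol f ((q : ℚ) / 8) =
      ∑ u : ZMod q, ratPlusSymbol f (1 / 8 + twistShift u) + ratPlusSymbol f (1 / 8) := by
  haveI : Fact q.Prime := ⟨hq⟩
  have hH := intCast_mul_normalizedPlusSymbol q hf hq hqN ha ((q : ℚ) / 8)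
  -- `q · (q/8) = 1/8 + k` with `k = (q² − 1)/8 ∈ ℤ`
  obtain ⟨k, hk⟩ : ∃ k : ℤ, (q : ℤ) ^ 2 - 1 = 8 * k := by
    obtain ⟨t, ht⟩ := hq.odd_of_ne_two hq2
    obtain ⟨s, hs⟩ := Int.even_mul_succ_self (t : ℤ)
    refine ⟨s, ?_⟩
    have hq' : (q : ℤ) = 2 * t + 1 := by exact_mod_cast ht
    rw [hq']
    linear_combination 4 * hs
  have hqq : (q : ℚ) * ((q : ℚ) / 8) = 1 / 8 + (k : ℚ) := by
    have hk' : ((q : ℚ)) ^ 2 - 1 = 8 * (k : ℚ) := by exact_mod_cast hk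
    linear_combination hk' / 8
  have hq0 : (q : ℚ) ≠ 0 := by exact_mod_cast hq.ne_zero
  have hper : normalizedPlusSymbol f ((q : ℚ) * ((q : ℚ) / 8)) = normalizedPlusSymbol f (1 / 8) := by
    rw [hqq, normalizedPlusSymbol_add_intCast]
  have hterm : ∀ j : Fin q, normalizedPlusSymbol f ((((q : ℚ) / 8) + (j : ℕ)) / q) =
      normalizedPlusSymbol f (1 / 8 + (j : ℕ) / (q : ℚ)) := by
    intro j
    congr 1
    field_simp
  rw [hper, Finset.sum_congr rfl (fun j _ ↦ hterm j)] at hH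
  -- pass to the rational symbols
  simp only [← ratCast_ratPlusSymbol_holds hf hQ] at hH
  rw [sum_zmod_twistShift_eq_sum_fin (fun x ↦ ratPlusSymbol f (1 / 8 + x))]
  exact_mod_cast hH

/-- **The exact identity for the twisted eighth sum**:
`∑_u ε(u)[1/8 + u/q]⁺ = a_q [q/8]⁺ − 2[1/8]⁺ − (∑_u (1 − ε(u))[1/8 + u/q]⁺ − [1/8]⁺)`.
[cite: MazurTateTeitelbaum1986Invent, §I.4 (4.2)] -/
theorem twistedEighthSum_eq (hf : IsNewform0 f) (hQ : coeffField f = ⊥)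
    {q : ℕ} [NeZero q] (hq : q.Prime) (hq2 : q ≠ 2) (hqN : ¬ q ∣ N) {a : ℤ} (ha : cuspCoeff f q = a)
    (ε : ZMod q → ℤ) :
    ∑ u : ZMod q, (ε u : ℚ) * ratPlusSymbol f (1 / 8 + twistShift u) =
      (a : ℚ) * ratPlusSymbol f ((q : ℚ) / 8) - 2 * ratPlusSymbol f (1 / 8)
        - (∑ u : ZMod q, (1 - (ε u : ℚ)) * ratPlusSymbol f (1 / 8 + twistShift u)
            - ratPlusSymbol f (1 / 8)) := by
  have h := intCast_mul_ratPlusSymbol_div_eight hf hQ hq hq2 hqN ha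
  have hsplit : ∑ u : ZMod q, (ε u : ℚ) * ratPlusSymbol f (1 / 8 + twistShift u) =
      ∑ u : ZMod q, ratPlusSymbol f (1 / 8 + twistShift u)
        - ∑ u : ZMod q, (1 - (ε u : ℚ)) * ratPlusSymbol f (1 / 8 + twistShift u) := by
    rw [← Finset.sum_sub_distrib]
    refine Finset.sum_congr rfl fun u _ ↦ ?_
    ring
  rw [hsplit]
  linear_combination -h

/-- **Parity of the twisted eighth sum.** If `a_q` is odd, `[q/8]⁺_f` is a `2`-adic unit,
`[1/8]⁺_f ∈ ℤ₍₂₎` and `‖∑_u (1 − ε(u))[1/8 + u/q]⁺ − [1/8]⁺‖₂ ≤ 1/2` (for `ε = (·/q)`: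
the QNR half-sum `∑_{(u/q)=−1} [1/8 + u/q]⁺_f` is `2`-integral), then `∑_u ε(u)[1/8 + u/q]⁺_f` is a
`2`-adic UNIT (ultrametric inequality on `twistedEighthSum_eq`). [cite: MazurTateTeitelbaum1986Invent, §I.4 (4.2)] -/
theorem norm_twistedEighthSum_eq_one (hf : IsNewform0 f) (hQ : coeffField f = ⊥)
    {q : ℕ} [NeZero q] (hq : q.Prime) (hq2 : q ≠ 2) (hqN : ¬ q ∣ N) {a : ℤ} (ha : cuspCoeff f q = a)
    (hodd : Odd a) (ε : ZMod q → ℤ)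
    (h8q : ‖((ratPlusSymbol f ((q : ℚ) / 8) : ℚ) : ℚ_[2])‖ = 1)
    (h8 : ‖((ratPlusSymbol f (1 / 8) : ℚ) : ℚ_[2])‖ ≤ 1)
    (hM : ‖((∑ u : ZMod q, (1 - (ε u : ℚ)) * ratPlusSymbol f (1 / 8 + twistShift u)
            - ratPlusSymbol f (1 / 8) : ℚ) : ℚ_[2])‖ ≤ 2⁻¹) :
    ‖((∑ u : ZMod q, (ε u : ℚ) * ratPlusSymbol f (1 / 8 + twistShift u) : ℚ) : ℚ_[2])‖ = 1 := by
  rw [twistedEighthSum_eq hf hQ hq hq2 hqN ha ε]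
  set A : ℚ_[2] := ((ratPlusSymbol f ((q : ℚ) / 8) : ℚ) : ℚ_[2]) with hA
  set B : ℚ_[2] := ((ratPlusSymbol f (1 / 8) : ℚ) : ℚ_[2]) with hB
  set M : ℚ_[2] := ((∑ u : ZMod q, (1 - (ε u : ℚ)) * ratPlusSymbol f (1 / 8 + twistShift u)
            - ratPlusSymbol f (1 / 8) : ℚ) : ℚ_[2]) with hMdef
  have hcast : (((a : ℚ) * ratPlusSymbol f ((q : ℚ) / 8) - 2 * ratPlusSymbol f (1 / 8)
        - (∑ u : ZMod q, (1 - (ε u : ℚ)) * ratPlusSymbol f (1 / 8 + twistShift u)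
            - ratPlusSymbol f (1 / 8)) : ℚ) : ℚ_[2]) = (a : ℚ_[2]) * A - ((2 : ℚ_[2]) * B + M) := by
    rw [hA, hB, hMdef]
    push_cast
    ring
  rw [hcast]
  -- the norms of the three pieces
  have ha1 : ‖(a : ℚ_[2])‖ = 1 := by
    refine le_antisymm (Padic.norm_int_le_one a) (not_lt.mp fun hlt ↦ ?_)
    have h2 : (2 : ℤ) ∣ a := by exact_mod_cast (Padic.norm_intCast_lt_one_iff (p := 2)).mp hlt
    exact (Int.not_even_iff_odd.mpr hodd) (even_iff_two_dvd.mpr h2)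
  have hmain : ‖(a : ℚ_[2]) * A‖ = 1 := by rw [norm_mul, ha1, h8q, one_mul]
  have h2B : ‖(2 : ℚ_[2]) * B‖ ≤ 2⁻¹ := by
    rw [norm_mul, show ((2 : ℚ_[2])) = ((2 : ℕ) : ℚ_[2]) by norm_cast, Padic.norm_p]
    push_cast
    calc (2 : ℝ)⁻¹ * ‖B‖ ≤ 2⁻¹ * 1 := by gcongr
      _ = 2⁻¹ := by ring
  have hrest : ‖(2 : ℚ_[2]) * B + M‖ ≤ 2⁻¹ :=
    (IsUltrametricDist.norm_add_le_max _ _).trans (max_le h2B hM)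
  have hne : ‖(a : ℚ_[2]) * A‖ ≠ ‖(2 : ℚ_[2]) * B + M‖ := by
    rw [hmain]
    intro h
    have : (1 : ℝ) ≤ 2⁻¹ := h ▸ hrest
    norm_num at this
  have hne' : ‖(a : ℚ_[2]) * A‖ ≠ ‖-((2 : ℚ_[2]) * B + M)‖ := by rwa [norm_neg]
  rw [sub_eq_add_neg, IsUltrametricDist.norm_add_eq_max_of_norm_ne_norm hne', norm_neg, hmain]
  exact max_eq_left (hrest.trans (by norm_num))

end TwistEngine

section TwistDoor

/-! ### The twisted equality door: `rank = corank Sel_{2^∞} = ord_{T=0} L₂ = 2` for a quadratic twist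

Setting: `f₀` a rational newform of level `N₀` (the curve `E₀`), `q ∤ N₀` an odd prime, `χ` the even
primitive quadratic character mod `q` (so `q ≡ 1 (4)`, `χ = (·/q)`), `F = f₀ ⊗ χ = charTwist L … f₀` the
twisted newform of level `L` (the curve `E = E₀^{(q)}`), `W` a global minimal model of `E` with
`IsNewformOf W F`, good ordinary at `2`. HYPOTHESES beyond the kernel: the period ratio of MTT §I.8 is a
rational `2`-adic unit (`hper`: `u · Ω⁺_F · g(χ) = Ω⁺_{f₀}`, `‖u‖₂ = 1`; for `E₀^{(q)}`:
`Ω_{E₀^{(q)}} √q = ± Ω_{E₀}`), `a_q(f₀)` odd, `[q/8]⁺_{f₀}` a `2`-adic unit, `[1/8]⁺_{f₀} ∈ ℤ₍₂₎`, and the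
QNR HALF-SUM INTEGRALITY `hM` — the one arithmetic input (numerically: it holds for every prime
`q ≡ 1 (4)` with `a_q(E₀)` odd and `χ_q(N₀) = +1`, kit j326305: 223/223). CONCLUSION: Kato's bound at
`2` + planted rank `≥ 2` ⇒ `rank E(ℚ) = corank Sel_{2^∞}(E) = ord_{T=0} L₂(E,T) = 2`, `Ш(E)[2^∞]` finite
(corank `0`). -/

variable {N₀ : ℕ} [NeZero N₀] {q : ℕ} [NeZero q] (L : ℕ) [NeZero L]
variable {W : WeierstrassCurve ℚ} [W.IsElliptic] [W.IsGloballyMinimal]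

/-- **`[1/8]⁺` of the twist is a `2`-adic unit** under the engine hypotheses (one-constant twisting
formula `exists_rat_forall_ratPlusSymbol_charTwist_eq` + `norm_twistedEighthSum_eq_one` + the unit period
ratio). [cite: MazurTateTeitelbaum1986Invent, §I.8] -/
theorem norm_ratPlusSymbol_charTwist_eighth_eq_one (hN : N₀ ∣ L) (hm : q ^ 2 ∣ L)
    {χ : DirichletCharacter ℂ q} (hχ : χ.IsQuadratic) (hχe : χ.Even) (hχp : χ.IsPrimitive)
    {f₀ : CuspForm (Gamma0 N₀) 2} (hf₀ : IsNewform0 f₀) (hQ₀ : coeffField f₀ = ⊥)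
    (hF : IsNewform0 (charTwist L hN hm hχ f₀)) (hQF : coeffField (charTwist L hN hm hχ f₀) = ⊥)
    (ε : ZMod q → ℤ) (hε : ∀ u, χ u = (ε u : ℂ))
    (hper : ∃ u : ℚ, ‖(u : ℚ_[2])‖ = 1 ∧
      (u : ℂ) * (plusPeriod (charTwist L hN hm hχ f₀) : ℂ) * gaussSum χ (ZMod.stdAddChar (N := q)) =
        (plusPeriod f₀ : ℂ))
    (hq : q.Prime) (hq2 : q ≠ 2) (hqN : ¬ q ∣ N₀) {a : ℤ} (ha : cuspCoeff f₀ q = a) (hodd : Odd a)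
    (h8q : ‖((ratPlusSymbol f₀ ((q : ℚ) / 8) : ℚ) : ℚ_[2])‖ = 1)
    (h8 : ‖((ratPlusSymbol f₀ (1 / 8) : ℚ) : ℚ_[2])‖ ≤ 1)
    (hM : ‖((∑ u : ZMod q, (1 - (ε u : ℚ)) * ratPlusSymbol f₀ (1 / 8 + twistShift u)
            - ratPlusSymbol f₀ (1 / 8) : ℚ) : ℚ_[2])‖ ≤ 2⁻¹) :
    ‖((ratPlusSymbol (charTwist L hN hm hχ f₀) (1 / 8) : ℚ) : ℚ_[2])‖ = 1 := by
  obtain ⟨c, hc, hcΩ⟩ :=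
    exists_rat_forall_ratPlusSymbol_charTwist_eq L hN hm hχ hχe hχp hf₀ hQ₀ hF hQF ε hε
  have hV := norm_twistedEighthSum_eq_one hf₀ hQ₀ hq hq2 hqN ha hodd ε h8q h8 hM
  have hV0 : ∑ u : ZMod q, (ε u : ℚ) * ratPlusSymbol f₀ (1 / 8 + twistShift u) ≠ 0 := by
    intro h0
    rw [h0] at hV
    simp at hV
  obtain ⟨u, hu1, huΩ⟩ := hper
  have hcΩ' := hcΩ ⟨1 / 8, hV0⟩
  -- `c = u`: both solve `x · Ω⁺_F · g(χ) = Ω⁺_{f₀}` with `Ω⁺_F · g(χ) ≠ 0`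
  have hg : gaussSum χ (ZMod.stdAddChar (N := q)) ≠ 0 := gaussSum_stdAddChar_ne_zero_of_isPrimitive hχp
  have hΩF : (plusPeriod (charTwist L hN hm hχ f₀) : ℂ) ≠ 0 := by
    exact_mod_cast (IsNewform0.plusPeriod_pos_holds hF hQF).ne'
  have hcu : (c : ℂ) = (u : ℂ) :=
    mul_right_cancel₀ hΩF (mul_right_cancel₀ hg (hcΩ'.trans huΩ.symm))
  have hcu' : c = u := by exact_mod_cast hcu
  rw [hc (1 / 8), hcu']
  push_cast
  rw [norm_mul, hu1, one_mul]
  exact_mod_cast hV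

/-- **The twisted equality door (parity-free, any level).** For the twist `E = E₀^{(q)}` (global minimal
model `W`, newform `F = f₀ ⊗ χ_q`), good ordinary at `2`: the engine hypotheses of
`norm_ratPlusSymbol_charTwist_eighth_eq_one` (unit period ratio, `a_q(E₀)` odd, `[q/8]⁺_{f₀}` a unit,
`[1/8]⁺_{f₀} ∈ ℤ₍₂₎`, QNR half-sum `2`-integral) + Kato's bound at `2` + planted `rank E(ℚ) ≥ 2` ⇒
`rank E(ℚ) = corank Sel_{2^∞}(E) = ord_{T=0} L₂(E,T) = 2` and `corank Ш(E)[2^∞] = 0`.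
[cite: Kato2004Asterisque, Thm. 18.4 (p. 281)] [cite: MazurTateTeitelbaum1986Invent, §I.8 and §I.14] -/
theorem rank_eq_two_of_twistedEighth (hN : N₀ ∣ L) (hm : q ^ 2 ∣ L)
    {χ : DirichletCharacter ℂ q} (hχ : χ.IsQuadratic) (hχe : χ.Even) (hχp : χ.IsPrimitive)
    {f₀ : CuspForm (Gamma0 N₀) 2} (hf₀ : IsNewform0 f₀) (hQ₀ : coeffField f₀ = ⊥)
    (hord : IsOrdinaryAt W 2) (hF : IsNewformOf W (charTwist L hN hm hχ f₀))
    (ε : ZMod q → ℤ) (hε : ∀ u, χ u = (ε u : ℂ))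
    (hper : ∃ u : ℚ, ‖(u : ℚ_[2])‖ = 1 ∧
      (u : ℂ) * (plusPeriod (charTwist L hN hm hχ f₀) : ℂ) * gaussSum χ (ZMod.stdAddChar (N := q)) =
        (plusPeriod f₀ : ℂ))
    (hq : q.Prime) (hq2 : q ≠ 2) (hqN : ¬ q ∣ N₀) {a : ℤ} (ha : cuspCoeff f₀ q = a) (hodd : Odd a)
    (h8q : ‖((ratPlusSymbol f₀ ((q : ℚ) / 8) : ℚ) : ℚ_[2])‖ = 1)
    (h8 : ‖((ratPlusSymbol f₀ (1 / 8) : ℚ) : ℚ_[2])‖ ≤ 1)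
    (hM : ‖((∑ u : ZMod q, (1 - (ε u : ℚ)) * ratPlusSymbol f₀ (1 / 8 + twistShift u)
            - ratPlusSymbol f₀ (1 / 8) : ℚ) : ℚ_[2])‖ ≤ 2⁻¹)
    (hKato : kato_selmerCorank_le_order_padicLFunction_allPrimes W 2 (f := charTwist L hN hm hχ f₀))
    (hrank : 2 ≤ W.mordellWeilRank) :
    W.mordellWeilRank = 2 ∧ W.selmerCorank 2 = 2 ∧ W.shaCorank 2 = 0 ∧
      (padicLFunction (charTwist L hN hm hχ f₀) (unitRoot W 2 : ℚ_[2])).order = (2 : ℕ) := by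
  have h1 := norm_ratPlusSymbol_charTwist_eighth_eq_one L hN hm hχ hχe hχp hf₀ hQ₀ hF.1
    hF.coeffField_eq_bot ε hε hper hq hq2 hqN ha hodd h8q h8 hM
  exact rank_eq_selmerCorank_eq_order_of_eighthSymbol₀ hord hF 1 (by rw [h1]; norm_num) hKato hrank

/-- **Unconditional analytic half of the twisted door**: under the engine hypotheses and `L(E,1) = 0`,
`ord_{T=0} L₂(E,T) ≤ 2` (χ₈-floor with `S₈(F) = 4[1/8]⁺_F`, INT2-AUTO); no Kato, no planted points.
[cite: MazurTateTeitelbaum1986Invent, §I.8 and §I.14] -/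
theorem order_padicLFunction_le_two_of_twistedEighth (hN : N₀ ∣ L) (hm : q ^ 2 ∣ L)
    {χ : DirichletCharacter ℂ q} (hχ : χ.IsQuadratic) (hχe : χ.Even) (hχp : χ.IsPrimitive)
    {f₀ : CuspForm (Gamma0 N₀) 2} (hf₀ : IsNewform0 f₀) (hQ₀ : coeffField f₀ = ⊥)
    (hord : IsOrdinaryAt W 2) (hF : IsNewformOf W (charTwist L hN hm hχ f₀))
    (hL : W.entireLFunction 1 = 0)
    (ε : ZMod q → ℤ) (hε : ∀ u, χ u = (ε u : ℂ))
    (hper : ∃ u : ℚ, ‖(u : ℚ_[2])‖ = 1 ∧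
      (u : ℂ) * (plusPeriod (charTwist L hN hm hχ f₀) : ℂ) * gaussSum χ (ZMod.stdAddChar (N := q)) =
        (plusPeriod f₀ : ℂ))
    (hq : q.Prime) (hq2 : q ≠ 2) (hqN : ¬ q ∣ N₀) {a : ℤ} (ha : cuspCoeff f₀ q = a) (hodd : Odd a)
    (h8q : ‖((ratPlusSymbol f₀ ((q : ℚ) / 8) : ℚ) : ℚ_[2])‖ = 1)
    (h8 : ‖((ratPlusSymbol f₀ (1 / 8) : ℚ) : ℚ_[2])‖ ≤ 1)
    (hM : ‖((∑ u : ZMod q, (1 - (ε u : ℚ)) * ratPlusSymbol f₀ (1 / 8 + twistShift u)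
            - ratPlusSymbol f₀ (1 / 8) : ℚ) : ℚ_[2])‖ ≤ 2⁻¹) :
    (padicLFunction (charTwist L hN hm hχ f₀) (unitRoot W 2 : ℚ_[2])).order ≤ (2 : ℕ) := by
  have h1 := norm_ratPlusSymbol_charTwist_eighth_eq_one L hN hm hχ hχe hχp hf₀ hQ₀ hF.1
    hF.coeffField_eq_bot ε hε hper hq hq2 hqN ha hodd h8q h8 hM
  have hS := chi8Floor_of_eighthSymbol hord hF hL 1 (by rw [h1]; norm_num)
  exact order_padicLFunction_le_of_chi8Floor hord hF 2 0
    (fun k ↦ by simpa using padicLFunction_integral_two_auto hord hF k) (by simpa using hS)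

end TwistDoor

end Summit.BirchSwinnertonDyer.Rank2

end
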